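import Summits.CriticalPhenomena.SAWScalingLimit.Theorems.SAWDefectDecoherenceBoundaryClosureRPhaseClassify
import Summits.CriticalPhenomena.SAWScalingLimit.Theorems.SAWDefectDecoherenceBoundaryClosureRPhaseCornerChart
import HarnessLib

/-!
# Crux `BoundaryClosureR` (stmt-CriticalPhenomena-14004), line `polygon-parity-squeeze`:
# stub `boundaryPhaseBookkeeping` — piece D of the (A) assembly of `stub_polygonIdentification`

**Boundary phase bookkeeping.** For an exact-polygon admissible pinned datum with a conformal
frame `(Φ, L, L_b)` (`Φ : Ω → ℍₒ`, `a ↦ ∞`, `b ↦ 0`, `L` a continuous logarithm of `Φ'` with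
`L → L_b` at `b`) and a unit boundary phase `κ` which is locally constant on flat stretches
(`K2c`), equal to `1` on the gate (`K3`) and jumps by `e^{-i(5/8)T}` across the corners (`K4`,
`T = arg(n_{k'}/n_k)` the turning angle): at every flat boundary point `z ≠ a` of form `k` the
boundary value `α` of `im L = arg Φ'` within `Ω` exists and

  `κ(z) · n_k · e^{i(3/8)α} = i · e^{i(3/8) im L_b}`.

Proof (folklore bookkeeping, Duminil-Copin–Smirnov 2012 §3 "winding of the boundary"): the
product `Π = κ · n_k · e^{i(3/8)α}` takes one value on the flat points near every point of
`∂Ω ∖ {a}` (`PhaseBook.local_rigidity`: on a flat stretch `κ`, `k`, `α` are constant; across a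
corner `κ ↦ e^{-i(5/8)T}κ`, `n ↦ e^{iT}n`, `α ↦ α - T` by the corner structure of `Φ`, and
`-5/8 + 1 - 3/8 = 0`); `∂Ω ∖ {a}` is preconnected (an open arc of the boundary loop) and flat
points are dense in it, so the sets where the local value is `= P₀` resp. `≠ P₀` are open and
cannot both meet it; at the gate point `b` (flat of form `0`, `n_0 = i`, `κ = 1`, `α = im L_b`)
the value is `P₀ = i e^{i(3/8) im L_b}`.

## Local rigidity (`PhaseBook.local_rigidity`)

For an exact polygon family with a conformal frame `(Φ, L)` and a unit boundary phase `κ` which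
is locally constant on flat stretches (`K2c`) and jumps by `e^{-i(5/8)T}` across genuine corners
(`K4`), the PRODUCT `Π(q, k, α) = κ(q) · n_k · e^{i(3/8)α}` — `k` the form of a flat ball about
`q`, `α` the boundary value of `im L` at `q` — takes ONE value on all flat points of `∂Ω ∖ {a}`
near any given point of `∂Ω ∖ {a}` (`local_rigidity`):

* near a flat point: `κ` is constant (`K2c`), the form is constant (`form_unique`), `α` is
  constant (`flatChart`);
* near a side point `p ≠ c` of a genuine corner `c`: `κ` is constant (`K4` with a fixed partner
  on the other side), form and `α` as before;
* at a genuine corner `c`: across the corner `κ ↦ e^{-i(5/8)T} κ` (`K4`), `n ↦ e^{iT} n`,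
  `α ↦ α - T` (`cornerChart`), and `-5/8 + 1 - 3/8 = 0`.

All statements are folklore bookkeeping.
-/

noncomputable section

open scoped Topology ComplexConjugate
open Filter Set Metric Complex
open UpperHalfPlane (upperHalfPlaneSet)
open Literature.Probability.LatticeModels Literature.Probability.RandomPlanarGeometry
open Summit.CriticalPhenomena.SAWScalingLimit.Theorems.PickHalfPlane

namespace Summit.CriticalPhenomena.SAWScalingLimit.Theorems.PolygonParitySqueeze

namespace PhaseBook

/-- The form of a flat ball about a point which is flat of form `k₀` in another ball is `k₀`.
[folklore] -/
theorem form_eq_of_flat {U : Set ℂ} {q : ℂ} {k k₀ : Fin 6} {s s₀ : ℝ} (hs : 0 < s) (hs₀ : 0 < s₀)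
    (h : U ∩ ball q s = halfPlane k q ∩ ball q s) (h₀ : U ∩ ball q s₀ = halfPlane k₀ q ∩ ball q s₀) :
    k = k₀ := by
  have h1 := PhaseGeometry.inter_eq_inter_of_subset_ball h (ball_subset_ball (min_le_left s s₀))
  have h2 := PhaseGeometry.inter_eq_inter_of_subset_ball h₀ (ball_subset_ball (min_le_right s s₀))
  exact PhaseGeometry.form_unique (lt_min hs hs₀) (h1.symm.trans h2)

/-- The phase algebra at a corner: `e^{-i(5/8)T} · e^{iT} · e^{i(3/8)(α - T)} = e^{i(3/8)α}`.
[folklore] -/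
theorem corner_phase_algebra (κ₁ n₁ : ℂ) (α T : ℝ) :
    exp (-(5 / 8 : ℂ) * (T : ℂ) * I) * κ₁ * (exp ((T : ℂ) * I) * n₁) *
        exp ((3 / 8 : ℂ) * ((α - T : ℝ) : ℂ) * I) =
      κ₁ * n₁ * exp ((3 / 8 : ℂ) * (α : ℂ) * I) := by
  have : exp (-(5 / 8 : ℂ) * (T : ℂ) * I) * exp ((T : ℂ) * I) * exp ((3 / 8 : ℂ) * ((α - T : ℝ) : ℂ) * I) =
      exp ((3 / 8 : ℂ) * (α : ℂ) * I) := by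
    rw [← exp_add, ← exp_add]
    congr 1
    push_cast
    ring
  linear_combination κ₁ * n₁ * this

/-- **Local rigidity of the boundary phase product.** See the module docstring. [folklore] -/
theorem local_rigidity (D : DobrushinDomain) (Λ : ℝ → Finset HexVertex)
    (hEx : ExactPolygonFamily D Λ) (Φ : ConformalEquiv D.carrier upperHalfPlaneSet)
    (hΦ0 : Tendsto (fun z => ‖Φ z‖) (𝓝[D.carrier] (D.pt 0)) atTop)
    {L : ℂ → ℂ} (hL : ContinuousOn L D.carrier) (hexp : ∀ z ∈ D.carrier, exp (L z) = deriv Φ z)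
    (κ : ℂ → ℂ)
    (hK2c : ∀ z ∈ frontier D.carrier, z ≠ D.pt 0 → ∀ (k : Fin 6) (s : ℝ), 0 < s →
      D.carrier ∩ Metric.ball z s = halfPlane k z ∩ Metric.ball z s →
      (∀ᶠ δ : ℝ in 𝓝[>] 0, ∃ nthr : ℤ, ∀ v : HexVertex, (δ : ℂ) * hexCenter v ∈ Metric.ball z s →
        (v ∈ Λ δ ↔ nthr ≤ zigzagForm k v)) →
      D.pt 0 ∉ Metric.closedBall z s → ∀ z' ∈ frontier D.carrier ∩ Metric.ball z s, κ z' = κ z)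
    (hK4 : ∀ z ∈ frontier D.carrier, ∀ (k k' : Fin 6) (s : ℝ), 0 < s →
      innerNormal k' ≠ innerNormal k → innerNormal k' ≠ -innerNormal k →
      (D.carrier ∩ Metric.ball z s = halfPlane k z ∩ halfPlane k' z ∩ Metric.ball z s ∨
        D.carrier ∩ Metric.ball z s = (halfPlane k z ∪ halfPlane k' z) ∩ Metric.ball z s) →
      (∀ᶠ δ : ℝ in 𝓝[>] 0, ∃ nk nk' : ℤ,
        (∀ v : HexVertex, (δ : ℂ) * hexCenter v ∈ Metric.ball z s →
          (v ∈ Λ δ ↔ (nk ≤ zigzagForm k v ∧ nk' ≤ zigzagForm k' v))) ∨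
        (∀ v : HexVertex, (δ : ℂ) * hexCenter v ∈ Metric.ball z s →
          (v ∈ Λ δ ↔ (nk ≤ zigzagForm k v ∨ nk' ≤ zigzagForm k' v)))) →
      D.pt 0 ∉ Metric.closedBall z s →
      ∀ z₁ ∈ frontier D.carrier ∩ Metric.ball z s, ∀ z₂ ∈ frontier D.carrier ∩ Metric.ball z s,
        z₁ ≠ z → ((z₁ - z) * (starRingEnd ℂ) (innerNormal k)).re = 0 → z₂ ≠ z →
        ((z₂ - z) * (starRingEnd ℂ) (innerNormal k')).re = 0 →
        κ z₂ = Complex.exp (-(5 / 8 : ℂ) * (Complex.arg (innerNormal k' / innerNormal k) : ℂ) *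
          Complex.I) * κ z₁)
    {p : ℂ} (hp : p ∈ frontier D.carrier) (hp0 : p ≠ D.pt 0) :
    ∃ t : ℝ, 0 < t ∧ ∃ P : ℂ, ∀ q ∈ frontier D.carrier ∩ ball p t,
      ∀ (k : Fin 6) (s : ℝ) (α : ℝ), 0 < s → D.carrier ∩ ball q s = halfPlane k q ∩ ball q s →
        Tendsto (fun w => (L w).im) (𝓝[D.carrier] q) (𝓝 α) →
        κ q * innerNormal k * exp ((3 / 8 : ℂ) * (α : ℂ) * I) = P := by
  have hU : IsOpen D.carrier := D.isOpen
  -- a flat ball about a frontier point with constant `κ`, root outside: rigidity near its centre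
  have hflatcase : ∀ {p : ℂ} {k₀ : Fin 6} {s₀ : ℝ}, p ∈ frontier D.carrier → 0 < s₀ →
      D.carrier ∩ ball p s₀ = halfPlane k₀ p ∩ ball p s₀ → D.pt 0 ∉ ball p s₀ →
      (∃ K₀ : ℂ, ∀ q ∈ frontier D.carrier ∩ ball p s₀, κ q = K₀) →
      ∃ t : ℝ, 0 < t ∧ ∃ P : ℂ, ∀ q ∈ frontier D.carrier ∩ ball p t,
        ∀ (k : Fin 6) (s : ℝ) (α : ℝ), 0 < s → D.carrier ∩ ball q s = halfPlane k q ∩ ball q s →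
          Tendsto (fun w => (L w).im) (𝓝[D.carrier] q) (𝓝 α) →
          κ q * innerNormal k * exp ((3 / 8 : ℂ) * (α : ℂ) * I) = P := by
    intro p k₀ s₀ hp hs₀ hflat₀ h0 hκ
    obtain ⟨K₀, hK₀⟩ := hκ
    obtain ⟨t₁, α₀, ht₁, ht₁s, -, hT₀⟩ :=
      PhaseChart.flatChart D Φ hΦ0 hL hexp (norm_innerNormal k₀) hs₀ hflat₀ h0
    refine ⟨t₁, ht₁, K₀ * innerNormal k₀ * exp ((3 / 8 : ℂ) * (α₀ : ℂ) * I), ?_⟩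
    rintro q ⟨hqfr, hqt⟩ k s α hs hflat hα
    have hqs₀ : q ∈ ball p s₀ := ball_subset_ball ht₁s hqt
    haveI : NeBot (𝓝[D.carrier] q) :=
      mem_closure_iff_nhdsWithin_neBot.1 (frontier_subset_closure hqfr)
    have hlev : ((q - p) * conj (innerNormal k₀)).re = 0 :=
      PhaseGeometry.level_eq_zero_of_mem_frontier hU hflat₀ hqfr hqs₀
    have hαeq : α = α₀ := tendsto_nhds_unique hα (hT₀ q hqt hlev)
    have hgap : 0 < s₀ - dist q p := by rw [sub_pos]; exact mem_ball.1 hqs₀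
    have hsub : ball q (s₀ - dist q p) ⊆ ball p s₀ := fun w hw => by
      rw [mem_ball] at hw ⊢; linarith [dist_triangle w q p]
    have hkeq : k = k₀ :=
      form_eq_of_flat hs hgap hflat (PhaseGeometry.flat_of_subset hflat₀ hsub hlev)
    rw [hK₀ q ⟨hqfr, hqs₀⟩, hkeq, hαeq]
  rcases classify D Λ hEx Φ hΦ0 hp hp0 with ⟨k₀, s₀, hs₀, hflat₀, hlat₀, h0₀⟩ |
    ⟨c, k, k', sc, hcfr, hsc, hk, hk', hset, hlat, h0c, hpc⟩
  · -- Case 1: a flat point of the family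
    exact hflatcase hp hs₀ hflat₀ (fun h => h0₀ (ball_subset_closedBall h))
      ⟨κ p, hK2c p hp hp0 k₀ s₀ hs₀ hflat₀ hlat₀ h0₀⟩
  · -- Case 2: a point of a genuine corner ball
    have h0b : D.pt 0 ∉ ball c sc := fun h => h0c (ball_subset_closedBall h)
    have hK := hK4 c hcfr k k' sc hsc hk hk' hset hlat h0c
    set T : ℝ := arg (innerNormal k' / innerNormal k) with hT
    set E : ℂ := exp (-(5 / 8 : ℂ) * (T : ℂ) * I) with hE
    have hE0 : E ≠ 0 := exp_ne_zero _
    have hset' : D.carrier ∩ ball c sc = halfPlane k' c ∩ halfPlane k c ∩ ball c sc ∨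
        D.carrier ∩ ball c sc = (halfPlane k' c ∪ halfPlane k c) ∩ ball c sc := by
      rcases hset with h | h
      · left; rw [h, inter_comm (halfPlane k c)]
      · right; rw [h, union_comm]
    have hks : innerNormal k ≠ innerNormal k' := hk.symm
    have hks' : innerNormal k ≠ -innerNormal k' := fun h => hk' (by rw [h, neg_neg])
    -- reference points on the two sides and `κ` on the two sides
    obtain ⟨w₁, ⟨hw₁fr, hw₁s⟩, hw₁c, hw₁lev⟩ :=
      PhaseGeometry.exists_mem_ray hU hk hk' hset hsc le_rfl
    obtain ⟨w₂, ⟨hw₂fr, hw₂s⟩, hw₂c, hw₂lev⟩ :=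
      PhaseGeometry.exists_mem_ray hU hks hks' hset' hsc le_rfl
    have hκk : ∀ q ∈ frontier D.carrier ∩ ball c sc, q ≠ c →
        ((q - c) * conj (innerNormal k)).re = 0 → κ q = E⁻¹ * κ w₂ := by
      intro q hq hqc hlev
      have h := hK q hq w₂ ⟨hw₂fr, hw₂s⟩ hqc hlev hw₂c hw₂lev
      rw [h, ← mul_assoc, inv_mul_cancel₀ hE0, one_mul]
    have hκk' : ∀ q ∈ frontier D.carrier ∩ ball c sc, q ≠ c →
        ((q - c) * conj (innerNormal k')).re = 0 → κ q = E * κ w₁ := fun q hq hqc hlev =>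
      hK w₁ ⟨hw₁fr, hw₁s⟩ q hq hw₁c hw₁lev hqc hlev
    by_cases hpc' : p = c
    · -- Case 2a: the apex itself
      subst hpc'
      obtain ⟨t₂, ht₂, ht₂s, hcc⟩ := PhaseChart.cornerChart D Φ hΦ0 hL hexp hcfr hk hk' hsc hset h0b
      -- reference side points inside the corner chart ball, with their boundary values
      obtain ⟨z₁, ⟨hz₁fr, hz₁t⟩, hz₁c, hz₁lev⟩ :=
        PhaseGeometry.exists_mem_ray hU hk hk' hset ht₂ ht₂s
      obtain ⟨z₂, ⟨hz₂fr, hz₂t⟩, hz₂c, hz₂lev⟩ :=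
        PhaseGeometry.exists_mem_ray hU hks hks' hset' ht₂ ht₂s
      have hz₁s : z₁ ∈ ball p sc := ball_subset_ball ht₂s hz₁t
      have hz₂s : z₂ ∈ ball p sc := ball_subset_ball ht₂s hz₂t
      have hz₁0 : z₁ ≠ D.pt 0 := fun h => h0b (h ▸ hz₁s)
      have hz₂0 : z₂ ≠ D.pt 0 := fun h => h0b (h ▸ hz₂s)
      obtain ⟨t₁', ht₁', -, hflat₁⟩ := PhaseGeometry.flat_of_mem_ray hU hk hk' hset hz₁fr hz₁s hz₁c hz₁lev
      obtain ⟨t₂', ht₂', -, hflat₂⟩ := PhaseGeometry.flat_of_mem_ray hU hks hks' hset' hz₂fr hz₂s hz₂c hz₂lev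
      obtain ⟨α₁, hα₁⟩ := exists_boundaryValue D Φ hΦ0 hL hexp hz₁0 ht₁' hflat₁
      obtain ⟨α₂, hα₂⟩ := exists_boundaryValue D Φ hΦ0 hL hexp hz₂0 ht₂' hflat₂
      have h12 : α₂ = α₁ - T := hcc z₁ ⟨hz₁fr, hz₁t⟩ hz₁c hz₁lev z₂ ⟨hz₂fr, hz₂t⟩ hz₂c hz₂lev α₁ α₂ hα₁ hα₂
      refine ⟨t₂, ht₂, κ z₁ * innerNormal k * exp ((3 / 8 : ℂ) * (α₁ : ℂ) * I), ?_⟩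
      rintro q ⟨hqfr, hqt⟩ j s α hs hflat hα
      have hqs : q ∈ ball p sc := ball_subset_ball ht₂s hqt
      have hqc : q ≠ p := by
        rintro rfl
        exact PhaseGeometry.not_flat_of_corner (lt_min hs hsc) hk
          (PhaseGeometry.inter_eq_inter_of_subset_ball hflat (ball_subset_ball (min_le_left s sc)))
          (hset.imp (fun h => PhaseGeometry.inter_eq_inter_of_subset_ball h (ball_subset_ball (min_le_right s sc)))
            (fun h => PhaseGeometry.inter_eq_inter_of_subset_ball h (ball_subset_ball (min_le_right s sc))))
      rcases PhaseGeometry.level_eq_zero_or_of_mem_frontier hU hset hqfr hqs with hlev | hlev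
      · -- `q` on the side of `H_k`
        have hκq : κ q = κ z₁ := by
          rw [hκk q ⟨hqfr, hqs⟩ hqc hlev, hκk z₁ ⟨hz₁fr, hz₁s⟩ hz₁c hz₁lev]
        have hαq : α = α₁ := by
          have h := hcc q ⟨hqfr, hqt⟩ hqc hlev z₂ ⟨hz₂fr, hz₂t⟩ hz₂c hz₂lev α α₂ hα hα₂
          linarith
        obtain ⟨tq, htq, -, hflatq⟩ := PhaseGeometry.flat_of_mem_ray hU hk hk' hset hqfr hqs hqc hlev
        have hjq : j = k := form_eq_of_flat hs htq hflat hflatq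
        rw [hκq, hαq, hjq]
      · -- `q` on the side of `H_{k'}`
        have hκq : κ q = E * κ z₁ := by
          rw [hκk' q ⟨hqfr, hqs⟩ hqc hlev, hκk w₁ ⟨hw₁fr, hw₁s⟩ hw₁c hw₁lev,
            hκk z₁ ⟨hz₁fr, hz₁s⟩ hz₁c hz₁lev]
        have hαq : α = α₁ - T := hcc z₁ ⟨hz₁fr, hz₁t⟩ hz₁c hz₁lev q ⟨hqfr, hqt⟩ hqc hlev α₁ α hα₁ hα
        obtain ⟨tq, htq, -, hflatq⟩ := PhaseGeometry.flat_of_mem_ray hU hks hks' hset' hqfr hqs hqc hlev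
        have hjq : j = k' := form_eq_of_flat hs htq hflat hflatq
        have hk0 : innerNormal k ≠ 0 := fun h => by
          have := norm_innerNormal k; rw [h, norm_zero] at this; exact zero_ne_one this
        have hnk' : innerNormal k' = exp ((T : ℂ) * I) * innerNormal k := by
          have h1 : ‖innerNormal k' / innerNormal k‖ = 1 := by
            rw [norm_div, norm_innerNormal, norm_innerNormal, div_one]
          have h2 := norm_mul_exp_arg_mul_I (innerNormal k' / innerNormal k)
          rw [h1, ofReal_one, one_mul, ← hT] at h2
          rw [h2, div_mul_cancel₀ _ hk0]
        rw [hκq, hαq, hjq, hnk', hE]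
        exact corner_phase_algebra (κ z₁) (innerNormal k) α₁ T
    · -- Case 2b: a side point `p ≠ c` of the corner
      have hpt : 0 < dist p c := dist_pos.2 hpc'
      rcases PhaseGeometry.level_eq_zero_or_of_mem_frontier hU hset hp hpc with hlev | hlev
      · obtain ⟨tp, htp, hsubp, hflatp⟩ := PhaseGeometry.flat_of_mem_ray hU hk hk' hset hp hpc hpc' hlev
        refine hflatcase hp (lt_min htp hpt)
          (PhaseGeometry.inter_eq_inter_of_subset_ball hflatp (ball_subset_ball (min_le_left _ _)))
          (fun h => h0b (hsubp (ball_subset_ball (min_le_left _ _) h))) ⟨E⁻¹ * κ w₂, ?_⟩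
        rintro q ⟨hqfr, hqt⟩
        have hqtp : q ∈ ball p tp := ball_subset_ball (min_le_left _ _) hqt
        have hqc : q ≠ c := by
          intro h; subst h
          have := mem_ball.1 (ball_subset_ball (min_le_right tp (dist p q)) hqt)
          rw [dist_comm] at this; exact lt_irrefl _ this
        have hlevq : ((q - c) * conj (innerNormal k)).re = 0 := by
          rw [PhaseGeometry.level_split k q p c, hlev, add_zero]
          exact PhaseGeometry.level_eq_zero_of_mem_frontier hU hflatp hqfr hqtp
        exact hκk q ⟨hqfr, hsubp hqtp⟩ hqc hlevq
      · obtain ⟨tp, htp, hsubp, hflatp⟩ := PhaseGeometry.flat_of_mem_ray hU hks hks' hset' hp hpc hpc' hlev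
        refine hflatcase hp (lt_min htp hpt)
          (PhaseGeometry.inter_eq_inter_of_subset_ball hflatp (ball_subset_ball (min_le_left _ _)))
          (fun h => h0b (hsubp (ball_subset_ball (min_le_left _ _) h))) ⟨E * κ w₁, ?_⟩
        rintro q ⟨hqfr, hqt⟩
        have hqtp : q ∈ ball p tp := ball_subset_ball (min_le_left _ _) hqt
        have hqc : q ≠ c := by
          intro h; subst h
          have := mem_ball.1 (ball_subset_ball (min_le_right tp (dist p q)) hqt)
          rw [dist_comm] at this; exact lt_irrefl _ this
        have hlevq : ((q - c) * conj (innerNormal k')).re = 0 := by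
          rw [PhaseGeometry.level_split k' q p c, hlev, add_zero]
          exact PhaseGeometry.level_eq_zero_of_mem_frontier hU hflatp hqfr hqtp
        exact hκk' q ⟨hqfr, hsubp hqtp⟩ hqc hlevq

end PhaseBook


/-- **Boundary phase bookkeeping** (registered stub `boundaryPhaseBookkeeping`, piece D of the
(A) assembly of `stub_polygonIdentification`, crux stmt-CriticalPhenomena-14004, line
`polygon-parity-squeeze`): along `∂Ω ∖ {a}` the product `κ · n_k · e^{i(3/8) arg Φ'}` of the
lattice side phase, the inner normal and the conformal boundary phase is constant, equal to its
gate value `i e^{i(3/8) im L_b}`.  See the module docstring.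
[cite: DuminilCopinSmirnov2012, §3] -/
theorem boundaryPhaseBookkeeping : ∀ (D : DobrushinDomain) (ρ : ℝ) (Λ : ℝ → Finset HexVertex) (m : ℝ → ℤ) (b : ℝ → Sym2 HexVertex), AdmissibleFamily D ρ Λ m b → ExactPolygonFamily D Λ → ∀ (a : ℝ → Sym2 HexVertex) (r₀ : ℝ) (m₀ : ℝ → ℤ), PinnedFlatRoot D Λ b (D.pt 0) a r₀ m₀ → 2 * ρ < dist (D.pt 0) (D.pt 1) → ∀ (Φ : ConformalEquiv D.carrier UpperHalfPlane.upperHalfPlaneSet) (L : ℂ → ℂ) (Lb : ℂ), ConformalFrame D Φ L Lb → ∀ (κ : ℂ → ℂ), (∀ z ∈ frontier D.carrier, ‖κ z‖ = 1) → (∀ z ∈ frontier D.carrier, z ≠ D.pt 0 → ∀ (k : Fin 6) (s : ℝ), 0 < s → D.carrier ∩ Metric.ball z s = halfPlane k z ∩ Metric.ball z s → (∀ᶠ δ : ℝ in 𝓝[>] 0, ∃ nthr : ℤ, ∀ v : HexVertex, (δ : ℂ) * hexCenter v ∈ Metric.ball z s → (v ∈ Λ δ ↔ nthr ≤ zigzagForm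 k v)) → D.pt 0 ∉ Metric.closedBall z s → ∀ z' ∈ frontier D.carrier ∩ Metric.ball z s, κ z' = κ z) → (∀ z ∈ frontier D.carrier ∩ Metric.ball (D.pt 1) ρ, κ z = 1) → (∀ z ∈ frontier D.carrier, ∀ (k k' : Fin 6) (s : ℝ), 0 < s → innerNormal k' ≠ innerNormal k → innerNormal k' ≠ -innerNormal k → (D.carrier ∩ Metric.ball z s = halfPlane k z ∩ halfPlane k' z ∩ Metric.ball z s ∨ D.carrier ∩ Metric.ball z s = (halfPlane k z ∪ halfPlane k' z) ∩ Metric.ball z s) → (∀ᶠ δ : ℝ in 𝓝[>] 0, ∃ nk nk' : ℤ, (∀ v : HexVertex, (δ : ℂ) * hexCenter v ∈ Metric.ball z s → (v ∈ Λ δ ↔ (nk ≤ zigzagForm k v ∧ nk' ≤ zigzagForm k' v))) ∨ (∀ v : HexVertex, (δ : ℂ) * hexCenter v ∈ Metric.ball z s → (v ∈ Λ δ ↔ (nk ≤ zigzagForm k v ∨ nk' ≤ zigzagForm k' v)))) → D.pt 0 ∉ Metric.closedBall z s → ∀ z₁ ∈ frontier D.carrier ∩ Metric.ball z s, ∀ z₂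 ∈ frontier D.carrier ∩ Metric.ball z s, z₁ ≠ z → ((z₁ - z) * (starRingEnd ℂ) (innerNormal k)).re = 0 → z₂ ≠ z → ((z₂ - z) * (starRingEnd ℂ) (innerNormal k')).re = 0 → κ z₂ = Complex.exp (-(5 / 8 : ℂ) * (Complex.arg (innerNormal k' / innerNormal k) : ℂ) * Complex.I) * κ z₁) → ∀ z ∈ frontier D.carrier, z ≠ D.pt 0 → ∀ (k : Fin 6) (s : ℝ), 0 < s → D.carrier ∩ Metric.ball z s = halfPlane k z ∩ Metric.ball z s → (∀ᶠ δ : ℝ in 𝓝[>] 0, ∃ nthr : ℤ, ∀ v : HexVertex, (δ : ℂ) * hexCenter v ∈ Metric.ball z s → (v ∈ Λ δ ↔ nthr ≤ zigzagForm k v)) → D.pt 0 ∉ Metric.closedBall z s → ∃ α : ℝ, Filter.Tendsto (fun w => (L w).im) (𝓝[D.carrier] z) (𝓝 α) ∧ κ z * innerNormal k * Complex.exp ((3 / 8 : ℂ) * (α : ℂ) * Complex.I) = Complex.I * Complex.exp ((3 / 8 : ℂ) * (Lb.im : ℂ) * Complex.I) := by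
  intro D ρ Λ m b hAdm hEx a r₀ m₀ _hPin _hρ Φ L Lb hframe κ _hK1 hK2c hK3 hK4 z hz hz0 k s hs hflat
    _hlat _h0
  obtain ⟨hΦ0, -, hLc, hLexp, hLb⟩ := hframe
  have hρ0 : 0 < ρ := hAdm.1
  have hgate : D.carrier ∩ ball (D.pt 1) ρ = halfPlane 0 (D.pt 1) ∩ ball (D.pt 1) ρ := by
    rw [halfPlane_zero]; exact hAdm.2.1
  -- the gate value of the product
  set P₀ : ℂ := Complex.I * Complex.exp ((3 / 8 : ℂ) * (Lb.im : ℂ) * Complex.I) with hP₀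
  -- the boundary off the root and the local rigidity of the product on it
  set S : Set ℂ := frontier D.carrier \ {D.pt 0} with hS
  have hSpc : IsPreconnected S := PhaseBook.isPreconnected_frontier_diff_root D
  have hLR : ∀ p ∈ S, ∃ t : ℝ, 0 < t ∧ ∃ P : ℂ, ∀ q ∈ frontier D.carrier ∩ ball p t,
      ∀ (j : Fin 6) (s : ℝ) (α : ℝ), 0 < s → D.carrier ∩ ball q s = halfPlane j q ∩ ball q s →
        Tendsto (fun w => (L w).im) (𝓝[D.carrier] q) (𝓝 α) →
        κ q * innerNormal j * Complex.exp ((3 / 8 : ℂ) * (α : ℂ) * Complex.I) = P :=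
    fun p hp => PhaseBook.local_rigidity D Λ hEx Φ hΦ0 hLc hLexp κ hK2c hK4 hp.1 hp.2
  -- the open sets where the local value is `= P₀`, resp. `≠ P₀`
  have hopen : ∀ Pr : ℂ → Fin 6 → ℝ → Prop, IsOpen {x : ℂ | ∃ t : ℝ, 0 < t ∧
      ∀ q ∈ S ∩ ball x t, ∀ (j : Fin 6) (s : ℝ) (α : ℝ), 0 < s →
        D.carrier ∩ ball q s = halfPlane j q ∩ ball q s →
        Tendsto (fun w => (L w).im) (𝓝[D.carrier] q) (𝓝 α) → Pr q j α} := by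
    intro Pr
    refine Metric.isOpen_iff.2 fun x hx => ?_
    obtain ⟨t, ht, h⟩ := hx
    refine ⟨t, ht, fun y hy => ⟨t - dist y x, by rw [sub_pos]; exact mem_ball.1 hy, fun q hq => h q ⟨hq.1, ?_⟩⟩⟩
    have h1 := mem_ball.1 hq.2
    rw [mem_ball]
    linarith [dist_triangle q y x]
  set u : Set ℂ := {x : ℂ | ∃ t : ℝ, 0 < t ∧
      ∀ q ∈ S ∩ ball x t, ∀ (j : Fin 6) (s : ℝ) (α : ℝ), 0 < s →
        D.carrier ∩ ball q s = halfPlane j q ∩ ball q s →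
        Tendsto (fun w => (L w).im) (𝓝[D.carrier] q) (𝓝 α) →
        κ q * innerNormal j * Complex.exp ((3 / 8 : ℂ) * (α : ℂ) * Complex.I) = P₀} with hu
  set v : Set ℂ := {x : ℂ | ∃ t : ℝ, 0 < t ∧
      ∀ q ∈ S ∩ ball x t, ∀ (j : Fin 6) (s : ℝ) (α : ℝ), 0 < s →
        D.carrier ∩ ball q s = halfPlane j q ∩ ball q s →
        Tendsto (fun w => (L w).im) (𝓝[D.carrier] q) (𝓝 α) →
        κ q * innerNormal j * Complex.exp ((3 / 8 : ℂ) * (α : ℂ) * Complex.I) ≠ P₀} with hv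
  have huo : IsOpen u := hopen fun q j α =>
    κ q * innerNormal j * Complex.exp ((3 / 8 : ℂ) * (α : ℂ) * Complex.I) = P₀
  have hvo : IsOpen v := hopen fun q j α =>
    κ q * innerNormal j * Complex.exp ((3 / 8 : ℂ) * (α : ℂ) * Complex.I) ≠ P₀
  have hSuv : S ⊆ u ∪ v := by
    intro p hpS
    obtain ⟨t, ht, P, hP⟩ := hLR p hpS
    by_cases hPe : P = P₀
    · exact Or.inl ⟨t, ht, fun q hq j s α hs hf hT => (hP q ⟨hq.1.1, hq.2⟩ j s α hs hf hT).trans hPe⟩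
    · exact Or.inr ⟨t, ht, fun q hq j s α hs hf hT he =>
        hPe ((hP q ⟨hq.1.1, hq.2⟩ j s α hs hf hT).symm.trans he)⟩
  -- the gate point lies in `S ∩ u`
  have h1fr : D.pt 1 ∈ frontier D.carrier := D.pt_mem_frontier 1
  have h10 : D.pt 1 ≠ D.pt 0 := fun h => absurd (D.pt_injective h) (by decide)
  have h1S : D.pt 1 ∈ S := ⟨h1fr, fun h => h10 (mem_singleton_iff.1 h)⟩
  have h1u : D.pt 1 ∈ u := by
    obtain ⟨t, ht, P, hP⟩ := hLR _ h1S
    have hT1 : Tendsto (fun w => (L w).im) (𝓝[D.carrier] (D.pt 1)) (𝓝 Lb.im) :=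
      (Complex.continuous_im.tendsto _).comp hLb
    have hκ1 : κ (D.pt 1) = 1 := hK3 _ ⟨h1fr, mem_ball_self hρ0⟩
    have hP1 := hP (D.pt 1) ⟨h1fr, mem_ball_self ht⟩ 0 ρ Lb.im hρ0 hgate hT1
    have hn0 : innerNormal 0 = Complex.I := by simp [innerNormal_eq]
    have hPP : P = P₀ := by rw [← hP1, hκ1, one_mul, hn0]
    exact ⟨t, ht, fun q hq j s α hs hf hT => (hP q ⟨hq.1.1, hq.2⟩ j s α hs hf hT).trans hPP⟩
  -- no point of `S` lies in `v` (preconnectedness and density of flat points)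
  have hSv : ∀ p ∈ S, p ∉ v := by
    intro p hpS hpv
    obtain ⟨q, hqS, ⟨tu, htu, hqu⟩, ⟨tv, htv, hqv⟩⟩ :=
      hSpc u v huo hvo hSuv ⟨D.pt 1, h1S, h1u⟩ ⟨p, hpS, hpv⟩
    obtain ⟨q', ⟨hq'fr, hq'b⟩, hq'0, j, s, hs, hf⟩ :=
      PhaseBook.exists_flat_near D Λ hEx Φ hΦ0 hqS.1 hqS.2 (lt_min htu htv)
    obtain ⟨α, hα⟩ := PhaseBook.exists_boundaryValue D Φ hΦ0 hLc hLexp hq'0 hs hf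
    have hq'S : q' ∈ S := ⟨hq'fr, fun h => hq'0 (mem_singleton_iff.1 h)⟩
    exact hqv q' ⟨hq'S, ball_subset_ball (min_le_right _ _) hq'b⟩ j s α hs hf hα
      (hqu q' ⟨hq'S, ball_subset_ball (min_le_left _ _) hq'b⟩ j s α hs hf hα)
  -- conclusion at `z`
  have hzS : z ∈ S := ⟨hz, fun h => hz0 (mem_singleton_iff.1 h)⟩
  have hzu : z ∈ u := (hSuv hzS).resolve_right (hSv z hzS)
  obtain ⟨t, ht, hall⟩ := hzu
  obtain ⟨α, hα⟩ := PhaseBook.exists_boundaryValue D Φ hΦ0 hLc hLexp hz0 hs hflat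
  exact ⟨α, hα, hall z ⟨hzS, mem_ball_self ht⟩ k s α hs hflat hα⟩

end Summit.CriticalPhenomena.SAWScalingLimit.Theorems.PolygonParitySqueeze

end
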